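import Summits.QuantumFields.YangMills.Theorems.FluctuationComparisonRegPrIntLS2BetaStageAxialLetters
import Summits.QuantumFields.YangMills.Theorems.FluctuationComparisonRegPrIntLS2BetaFeedbackRecursion
import HarnessLib

/-!
# S2β · the (D-stage) REL-TEL road — THE INHOMOGENEOUS DOCK: (D-stage) of ✓p823271 (`Ax := AxStage`) ⟸ the two-tower letter WITH FEEDBACK
# {(L♭) chart, (H♭♭) relative flap with the finer levels' `Σ_{u≤j} W j u·B_u` junk} + the displayed smallness `exp E·ΣΣ(√L)^{j−u}W ≤ ½`;
# `C_D = 8·(exp E·C∕(L−1))²` — the honest shape the relative key lemma's SIZE × ARC junk (px10 g23 §82) delivers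

Cell `ym3-torus` (rung R3 = continuum `SU(2)` Yang–Mills on T³ — NOT d = 4, NOT infinite volume, NOT a mass gap, NOT Clay).  Width seat «width 12» `ym3-torus-px12`
(gen 24), FREE px helper on crux `stmt-QuantumFields-20520`; `--kind proof --supports … --as helper`, count-neutral, DEFINITION-FREE (0 `def`∕`instance`∕`notation`∕`sorry`).

WHY (this seat's FINDING 13:07:55Z).  The relative key lemma's commutator junk is SIZE_u × the level-`u` RELATIVE BOND DEVIATIONS = the recursion's own
`B_u`, `u ≤ j` (the same level included: px10 g23's `β²` remark), propagated to level `j` — so the (H♭) slot `C·(√L)^j·S` of ✓p822621∕✓p823624 is too narrow for the actual discharger; (H♭♭) adds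
`+ Σ_{u≤j} W j u·B_u` with `W ≥ 0` displayed, and ✓`…FeedbackRecursion.recursion_feedback_sqrtL_le_zero` (fixed point: `max_t B_t(√L)^t`) closes the
system under `exp E·Σ_{j<m}Σ_{u≤j}(√L)^{j−u}·W j u ≤ ½` — `O(θ_J)` depth-free when SIZE comes from the BACKGROUND tower (`∝ θ_J L^{2u} L^{−2m}`) and the
weights are the sharp `(√L)^{j−1−u}` (bus count).  Everything else is ✓p823624 verbatim (towers as input, AxStage, the argmin moved to the fibre mate).
* §1 ★★ `dockRel_of_towers_feedback` — the pair inequality at `(U, (g_0⁻¹·g₀_0)•U₀)` with `C_D = 8·(exp E·C∕(L−1))²`.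
* §2 ★★★ `dStage_of_feedbackLetter (G) (HLW)` — ✓p823271's `hD` with `Ax := AxStage` from the feedback letter (R1)-chord discharged inside (✓p820752).

HONEST SCOPE.  Plumbing; `HLW` (the letter incl. `W` and its smallness) and (F-stage) are HYPOTHESES; nothing of Bałaban's analysis asserted
([Balaban1985RegularSpaces] Lemma 1 p.79, (1.29) p.81; [Balaban1985Variational] (4) p.278, Thm 1 p.279); (H♭♭), hIrr∕hA, GAP♯∘ (`stub_uniformFibreGapOrbit`),
S2β, crux 20520 and `YM3TorusSU2` are NOT proved; no registered stub is closed; rung R3 = SU(2) YM₃ on T³ — NOT d = 4, NOT infinite volume, NOT a mass gap,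
NOT Clay; the Yang–Mills mass gap is NOT proved.
-/

set_option autoImplicit false

noncomputable section

namespace Summit.QuantumFields.YangMills.Theorems.FluctuationComparisonRegPrIntLS2BetaStageAxialFeedback

open Finset
open scoped Real
open Literature.MathematicalPhysics.QuantumLattice (su2Quat)
open Literature.MathematicalPhysics.QuantumFieldTheory.Balaban1983to89
open T4Continuum T3ContinuumYM3Torus T3UnitScaleTilt T3TiltDescent T3LevelShift BlockAveraging
open T4CubeChartGnomonic (SU2)
open T4HaarSU2ExpChart (expPoint)
open T4ExpWindowSmallField (logVec)
open T3UnitLawDensityEML (ℰp)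
open T3ConstrainedMinimiser (fibre)
open T3PrintedRegularMinimiser (minActionRegPr)
open B10Eq27TorusAxialLog (rel axialT)
open Summit.QuantumFields.YangMills.Theorems.FluctuationComparisonRegPrIntLS2BetaArcBondSplit (sqrt_sum_sq_le_of_le_add)
open Summit.QuantumFields.YangMills.Theorems.FluctuationComparisonRegPrIntLS2BetaSqrtLRecursion (inv_pow_sq_eq)
open Summit.QuantumFields.YangMills.Theorems.FluctuationComparisonRegPrIntLS2BetaFeedbackRecursion (recursion_feedback_sqrtL_le_zero)
open Summit.QuantumFields.YangMills.Theorems.FluctuationComparisonRegPrIntLS2BetaWhitneyHatLiftRelative (sum_dist1_sq_lift_mul_inv_le)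
open Summit.QuantumFields.YangMills.Theorems.FluctuationComparisonRegPrIntLS2BetaHFlatOfRelativeLetter (residual_of_iter_eq)
open Summit.QuantumFields.YangMills.Theorems.FluctuationComparisonRegPrIntLS2BetaResidualGauge (gaugeAct_mul_eq gaugeAct_mem_argmin_iff_of_residual)
open Summit.QuantumFields.YangMills.Theorems.FluctuationComparisonRegPrIntLS2BetaClosePairOfOneStep (iter_eq_of_mem_fibre)
open Summit.QuantumFields.YangMills.Theorems.FluctuationComparisonRegPrIntLS2BetaRelGaugeOfRelativeLetter
  (dist1_gaugeAct_mul_inv_gaugeAct dist1_rel_plaqHol_gaugeAct_pair dist1_mul_inv_le_flap_add_lift sum_dist1_sq_eq_two_mul_sum_one_sub_reTr)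

variable (F : T3Family) {J K : ℕ}

/-- ★★ **REL-TEL DOCK WITH FEEDBACK, TOWERS AS INPUT**: as ✓p823624 `dockRel_of_towers`, with the relative flap letter (H♭♭) carrying the finer levels'
junk `Σ_{u≤j} W j u·B_u` and the displayed smallness `exp E·Σ_{j<K−J}Σ_{u≤j}(√L)^{j−u}·W j u ≤ ½`; conclusion at `(U, (g_0⁻¹·g₀_0)•U₀)` with
`C_D = 8·(exp E·C∕(L−1))²` (✓`recursion_feedback_sqrtL_le_zero`). [cite: Balaban1985RegularSpaces, (1.29) p.81, Lemma 1 p.79; Balaban1985Variational, (4) p.278] -/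
theorem dockRel_of_towers_feedback (hJK : J ≤ K) (hL : 1 < (F.L : ℝ)) {V : GaugeField (F.P J) 0 SU2}
    (U U₀ : GaugeField (F.P K) 0 SU2) (hU : U ∈ fibre F ℰp J K hJK V) (hU₀ : U₀ ∈ fibre F ℰp J K hJK V)
    (lift : (j : ℕ) → GaugeField (F.P K) (j + 1) SU2 → GaugeField (F.P K) j SU2)
    (hR1 : ∀ j, j < K - J → ∀ X X' : GaugeField (F.P K) (j + 1) SU2,
      ∑ b, dist1 (lift j X b * (lift j X' b)⁻¹) ^ 2 ≤ (F.L : ℝ) * ∑ e, ‖logVec (su2Quat (X e)) - logVec (su2Quat (X' e))‖ ^ 2)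
    (C E : ℝ) (hC : 0 < C) (g g₀ : (j : ℕ) → Site (F.P K) j → SU2)
    (hT1 : ∀ j, K - J ≤ j → ∀ y, g j y = 1) (hT1' : ∀ j, K - J ≤ j → ∀ y, g₀ j y = 1)
    (hT6 : ∀ X : GaugeField (F.P K) 0 SU2, Averaging.iter (fun k => blockAvg (P := F.P K) (j := k) ℰp) (K - J) (GaugeField.gaugeAct (fun x => (g 0 x)⁻¹) X) = Averaging.iter (fun k => blockAvg (P := F.P K) (j := k) ℰp) (K - J) X)
    (hres' : ∀ X : GaugeField (F.P K) 0 SU2, Averaging.iter (fun k => blockAvg (P := F.P K) (j := k) ℰp) (K - J) (GaugeField.gaugeAct (g₀ 0) X) = Averaging.iter (fun k => blockAvg (P := F.P K) (j := k) ℰp) (K - J) X)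
    (hH :
      ∃ (r e : ℕ → ℝ) (W : ℕ → ℕ → ℝ), (∀ j, 0 ≤ r j) ∧ (∀ j, 0 ≤ e j) ∧ (∀ j u, 0 ≤ W j u) ∧ ∑ j ∈ range (K - J), (r j + e j) ≤ E ∧
        Real.exp E * ∑ j ∈ range (K - J), ∑ u ∈ range (j + 1), Real.sqrt (F.L : ℝ) ^ (j - u) * W j u ≤ 1 / 2 ∧
        ∀ j, j < K - J →
          √(∑ b, ‖logVec (su2Quat (GaugeField.gaugeAct (g (j + 1)) (Averaging.iter (fun k => blockAvg (P := F.P K) (j := k) ℰp) (j + 1) U) b)) -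
                logVec (su2Quat (GaugeField.gaugeAct (g₀ (j + 1)) (Averaging.iter (fun k => blockAvg (P := F.P K) (j := k) ℰp) (j + 1) U₀) b))‖ ^ 2) ≤
            (1 + r j) * √(∑ b, dist1 (GaugeField.gaugeAct (g (j + 1)) (Averaging.iter (fun k => blockAvg (P := F.P K) (j := k) ℰp) (j + 1) U) b *
              (GaugeField.gaugeAct (g₀ (j + 1)) (Averaging.iter (fun k => blockAvg (P := F.P K) (j := k) ℰp) (j + 1) U₀) b)⁻¹) ^ 2) ∧
          √(∑ b, dist1 (GaugeField.gaugeAct (g j) (Averaging.iter (fun k => blockAvg (P := F.P K) (j := k) ℰp) j U) b *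
                (lift j (GaugeField.gaugeAct (g (j + 1)) (Averaging.iter (fun k => blockAvg (P := F.P K) (j := k) ℰp) (j + 1) U)) b)⁻¹ *
              (GaugeField.gaugeAct (g₀ j) (Averaging.iter (fun k => blockAvg (P := F.P K) (j := k) ℰp) j U₀) b *
                (lift j (GaugeField.gaugeAct (g₀ (j + 1)) (Averaging.iter (fun k => blockAvg (P := F.P K) (j := k) ℰp) (j + 1) U₀)) b)⁻¹)⁻¹) ^ 2) ≤
            Real.sqrt (F.L : ℝ) * e j * √(∑ b, dist1 (GaugeField.gaugeAct (g (j + 1)) (Averaging.iter (fun k => blockAvg (P := F.P K) (j := k) ℰp) (j + 1) U) b *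
              (GaugeField.gaugeAct (g₀ (j + 1)) (Averaging.iter (fun k => blockAvg (P := F.P K) (j := k) ℰp) (j + 1) U₀) b)⁻¹) ^ 2) +
              (C * Real.sqrt (F.L : ℝ) ^ j *
                √(∑ p, dist1 ((GaugeField.plaqHol (GaugeField.gaugeAct (g₀ 0) U₀) p)⁻¹ * GaugeField.plaqHol (GaugeField.gaugeAct (g 0) U) p) ^ 2) +
               ∑ u ∈ range (j + 1), W j u * √(∑ b, dist1 (GaugeField.gaugeAct (g u) (Averaging.iter (fun k => blockAvg (P := F.P K) (j := k) ℰp) u U) b *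
                  (GaugeField.gaugeAct (g₀ u) (Averaging.iter (fun k => blockAvg (P := F.P K) (j := k) ℰp) u U₀) b)⁻¹) ^ 2))) :
    (∀ U' : GaugeField (F.P K) 0 SU2, descendTo F ℰp J K hJK (GaugeField.gaugeAct (fun x => (g 0 x)⁻¹ * g₀ 0 x) U') = descendTo F ℰp J K hJK U') ∧
      ((F.L : ℝ)⁻¹) ^ (2 * (K - J)) * ∑ ℓ : PBond (F.P K) 0, dist1 (U ℓ * ((GaugeField.gaugeAct (fun x => (g 0 x)⁻¹ * g₀ 0 x) U₀) ℓ)⁻¹) ^ 2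
        ≤ 8 * (Real.exp E * C / (F.L - 1)) ^ 2 *
          ∑ p : Plaq (F.P K) 0, (1 - reTr ((GaugeField.plaqHol (GaugeField.gaugeAct (fun x => (g 0 x)⁻¹ * g₀ 0 x) U₀) p)⁻¹ * GaugeField.plaqHol U p)) := by
  set av : ∀ i, Averaging (F.P K) i SU2 := fun k => blockAvg (P := F.P K) (j := k) ℰp with hav
  obtain ⟨r, e, W, hr0, he0, hW0, hE, hsmall, hH⟩ := hH
  set B : ℕ → ℝ := fun j => √(∑ b, dist1 (GaugeField.gaugeAct (g j) (Averaging.iter av j U) b *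
      (GaugeField.gaugeAct (g₀ j) (Averaging.iter av j U₀) b)⁻¹) ^ 2) with hB
  set S : ℝ := √(∑ p, dist1 ((GaugeField.plaqHol (GaugeField.gaugeAct (g₀ 0) U₀) p)⁻¹ *
      GaugeField.plaqHol (GaugeField.gaugeAct (g 0) U) p) ^ 2) with hS
  have hB0 : ∀ j, 0 ≤ B j := fun j => Real.sqrt_nonneg _
  have hS0 : 0 ≤ S := Real.sqrt_nonneg _
  have htop : B (K - J) = 0 := by
    have h1 : Averaging.iter av (K - J) U = Averaging.iter av (K - J) U₀ := iter_eq_of_mem_fibre F hJK hU hU₀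
    have hg : g (K - J) = fun _ => 1 := funext (hT1 (K - J) le_rfl)
    have hg' : g₀ (K - J) = fun _ => 1 := funext (hT1' (K - J) le_rfl)
    simp only [hB, h1, hg, hg', mul_inv_cancel, GaugeGroup.dist1_one, ne_eq, OfNat.ofNat_ne_zero, not_false_eq_true, zero_pow,
      sum_const_zero, Real.sqrt_zero]
  have hrec : ∀ j, j < K - J → B j ≤ Real.sqrt (F.L : ℝ) * (1 + (r j + e j)) * B (j + 1) +
      (C * Real.sqrt (F.L : ℝ) ^ j * S + ∑ u ∈ range (j + 1), W j u * B u) := by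
    intro j hj
    obtain ⟨hLj, hHj⟩ := hH j hj
    have hsplit := sqrt_sum_sq_le_of_le_add (univ : Finset (PBond (F.P K) j)) (fun b _ => GaugeGroup.dist1_nonneg _)
      (fun b _ => dist1_mul_inv_le_flap_add_lift
        (GaugeField.gaugeAct (g j) (Averaging.iter av j U) b)
        (lift j (GaugeField.gaugeAct (g (j + 1)) (Averaging.iter av (j + 1) U)) b)
        (GaugeField.gaugeAct (g₀ j) (Averaging.iter av j U₀) b)
        (lift j (GaugeField.gaugeAct (g₀ (j + 1)) (Averaging.iter av (j + 1) U₀)) b))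
    have hlift : √(∑ b, dist1 (lift j (GaugeField.gaugeAct (g (j + 1)) (Averaging.iter av (j + 1) U)) b *
        (lift j (GaugeField.gaugeAct (g₀ (j + 1)) (Averaging.iter av (j + 1) U₀)) b)⁻¹) ^ 2) ≤
        Real.sqrt (F.L : ℝ) * ((1 + r j) * B (j + 1)) := by
      refine (Real.sqrt_le_sqrt (hR1 j hj _ _)).trans ?_
      rw [Real.sqrt_mul (Nat.cast_nonneg _)]
      exact mul_le_mul_of_nonneg_left hLj (Real.sqrt_nonneg _)
    calc B j ≤ _ := hsplit
      _ ≤ (Real.sqrt (F.L : ℝ) * e j * B (j + 1) + (C * Real.sqrt (F.L : ℝ) ^ j * S + ∑ u ∈ range (j + 1), W j u * B u)) +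
            Real.sqrt (F.L : ℝ) * ((1 + r j) * B (j + 1)) := add_le_add hHj hlift
      _ = Real.sqrt (F.L : ℝ) * (1 + (r j + e j)) * B (j + 1) + (C * Real.sqrt (F.L : ℝ) ^ j * S + ∑ u ∈ range (j + 1), W j u * B u) := by ring
  -- the fixed point
  have hsol := recursion_feedback_sqrtL_le_zero (F.L : ℝ) hL B (fun j => r j + e j) W (K - J) htop hB0
    (fun j => add_nonneg (hr0 j) (he0 j)) E hE hW0 C S hC.le hS0 hrec hsmall
  refine ⟨?_, ?_⟩
  · refine residual_of_iter_eq F hJK _ fun X => ?_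
    have e1 : GaugeField.gaugeAct (fun x => (g 0 x)⁻¹ * g₀ 0 x) X =
        GaugeField.gaugeAct (fun x => (g 0 x)⁻¹) (GaugeField.gaugeAct (g₀ 0) X) := by
      rw [← gaugeAct_mul_eq]; rfl
    rw [e1, hT6, hres']
  · have hd : ∑ ℓ : PBond (F.P K) 0, dist1 (U ℓ * ((GaugeField.gaugeAct (fun x => (g 0 x)⁻¹ * g₀ 0 x) U₀) ℓ)⁻¹) ^ 2 = B 0 ^ 2 := by
      rw [hB, Real.sq_sqrt (sum_nonneg fun _ _ => sq_nonneg _)]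
      exact sum_congr rfl fun ℓ _ => by rw [← dist1_gaugeAct_mul_inv_gaugeAct]; rfl
    have hSq : S ^ 2 = 2 * ∑ p : Plaq (F.P K) 0,
        (1 - reTr ((GaugeField.plaqHol (GaugeField.gaugeAct (fun x => (g 0 x)⁻¹ * g₀ 0 x) U₀) p)⁻¹ * GaugeField.plaqHol U p)) := by
      rw [hS, Real.sq_sqrt (sum_nonneg fun _ _ => sq_nonneg _), ← sum_dist1_sq_eq_two_mul_sum_one_sub_reTr]
      exact sum_congr rfl fun p _ => by rw [dist1_rel_plaqHol_gaugeAct_pair]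
    have hL0 : (0 : ℝ) < (F.L : ℝ) := by linarith
    have hL1 : 0 < (F.L : ℝ) - 1 := by linarith
    have hA0 : 0 ≤ 2 * (Real.exp E * C * S * ((F.L : ℝ) ^ (K - J) / ((F.L : ℝ) - 1))) := by positivity
    have hB0sq : B 0 ^ 2 ≤ (2 * (Real.exp E * C * S * ((F.L : ℝ) ^ (K - J) / ((F.L : ℝ) - 1)))) ^ 2 := pow_le_pow_left₀ (hB0 0) hsol 2
    have hpow : ((F.L : ℝ)⁻¹) ^ (2 * (K - J)) * ((F.L : ℝ) ^ (K - J)) ^ 2 = 1 := by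
      rw [← inv_pow_sq_eq, ← mul_pow, inv_mul_cancel₀ (pow_ne_zero _ hL0.ne'), one_pow]
    rw [hd]
    calc ((F.L : ℝ)⁻¹) ^ (2 * (K - J)) * B 0 ^ 2
        ≤ ((F.L : ℝ)⁻¹) ^ (2 * (K - J)) * (2 * (Real.exp E * C * S * ((F.L : ℝ) ^ (K - J) / ((F.L : ℝ) - 1)))) ^ 2 :=
          mul_le_mul_of_nonneg_left hB0sq (by positivity)
      _ = 4 * (Real.exp E * C / ((F.L : ℝ) - 1)) ^ 2 * S ^ 2 * (((F.L : ℝ)⁻¹) ^ (2 * (K - J)) * ((F.L : ℝ) ^ (K - J)) ^ 2) := by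
          field_simp
          ring
      _ = 8 * (Real.exp E * C / (F.L - 1)) ^ 2 * ∑ p : Plaq (F.P K) 0,
            (1 - reTr ((GaugeField.plaqHol (GaugeField.gaugeAct (fun x => (g 0 x)⁻¹ * g₀ 0 x) U₀) p)⁻¹ * GaugeField.plaqHol U p)) := by
          rw [hpow, hSq]; ring

/-- ★★★ **(D-stage) FROM THE FEEDBACK LETTER** — ✓p823271's `hD` with `Ax := AxStage` ⟸ the two-tower letter with feedback {(L♭) ∧ (H♭♭)} over the
geodesic hat lift (`HLW`, in `hD`'s prefix; `W` and its smallness displayed per instance); `C_D = 8·(exp E·C∕(L−1))²`; proof as ✓p823624 `dStage_of_letter`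
with §1. [cite: Balaban1985Variational, Thm 1 (8)-(10) p.279, (4) p.278; Balaban1985RegularSpaces, (1.29) p.81] -/
theorem dStage_of_feedbackLetter (G : (F : T3Family) → (J : ℕ) → GaugeField (F.P J) 0 (Matrix.specialUnitaryGroup (Fin 2) ℂ) → Prop)
    (HLW : ∀ (L : ℕ), ∃ c₀ : ℝ, 0 < c₀ ∧ c₀ ≤ 1 ∧ ∀ (cw : ℝ), 0 < cw → cw ≤ c₀ → ∃ pS : ℝ, ∀ (b₀ p₀ : ℝ), 0 < b₀ → pS ≤ p₀ → 0 < p₀ → ∃ ε₁ : ℝ, 0 < ε₁ ∧ ∀ (ε₀ : ℝ), 0 < ε₀ → ε₀ ≤ ε₁ →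
      ∃ γ₁ : ℝ, 0 < γ₁ ∧ ∃ E C : ℝ, 0 < C ∧ ∀ (F : T3Family) (γ : ℝ), F.L = L → 0 < γ → γ ≤ γ₁ →
        ∀ (J K : ℕ) (hJK : J ≤ K) (V : GaugeField (F.P J) 0 (Matrix.specialUnitaryGroup (Fin 2) ℂ)), PlaqSmall (θBal F.L γ (cw * b₀) p₀ J) V →
          G F J V →
          ∀ U₀ ∈ {U' : GaugeField (F.P K) 0 (Matrix.specialUnitaryGroup (Fin 2) ℂ) | U' ∈ fibre F ℰp J K hJK V ∧ U' ∈ histGood F ℰp (θBal F.L γ b₀ p₀) K J ∧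
              wilsonAction4 U' = minActionRegPr F J K hJK ε₀ V},
          ∀ U ∈ fibre F ℰp J K hJK V, U ∈ histGood F ℰp (θBal F.L γ b₀ p₀) K J →
          ∀ (wt : (j : ℕ) → PBond (F.P K) j → PBond (F.P K) (j + 1) → ℝ)
            (lift : (j : ℕ) → GaugeField (F.P K) (j + 1) SU2 → GaugeField (F.P K) j SU2),
            (∀ j b e, wt j b e = if e.dir = b.dir ∧ (b.src b.dir - emb e.src b.dir).val < (F.P K).L then
                ∏ ν ∈ Finset.univ.erase b.dir, max 0 (1 - ((rel (emb e.src) b.src ν).natAbs : ℝ) / (F.P K).L) else 0) →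
            (∀ j X b, lift j X b = expPoint (∑ e, wt j b e • ((((F.P K).L : ℕ) : ℝ)⁻¹ • logVec (su2Quat (X e))))) →
          ∀ g g₀ : (j : ℕ) → Site (F.P K) j → SU2,
            (∀ j, j < K - J → ∀ x, g j x =
              (axialT (lift j (GaugeField.gaugeAct (g (j + 1)) (Averaging.iter (fun k => blockAvg (P := F.P K) (j := k) ℰp) (j + 1) U)))
                  (emb (blockOf x)) x)⁻¹ *
                g (j + 1) (blockOf x) * axialT (Averaging.iter (fun k => blockAvg (P := F.P K) (j := k) ℰp) j U) (emb (blockOf x)) x) →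
            (∀ j, K - J ≤ j → ∀ y, g j y = 1) →
            (∀ j, j < K - J → ∀ y : Site (F.P K) (j + 1), g j (emb y) = g (j + 1) y) →
            (∀ X : GaugeField (F.P K) 0 SU2, ∀ j, j ≤ K - J →
              Averaging.iter (fun k => blockAvg (P := F.P K) (j := k) ℰp) j (GaugeField.gaugeAct (g 0) X) =
                GaugeField.gaugeAct (g j) (Averaging.iter (fun k => blockAvg (P := F.P K) (j := k) ℰp) j X)) →
            (∀ j, j < K - J → ∀ x,
              axialT (GaugeField.gaugeAct (g j) (Averaging.iter (fun k => blockAvg (P := F.P K) (j := k) ℰp) j U)) (emb (blockOf x)) x =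
                axialT (lift j (GaugeField.gaugeAct (g (j + 1)) (Averaging.iter (fun k => blockAvg (P := F.P K) (j := k) ℰp) (j + 1) U)))
                  (emb (blockOf x)) x) →
            (∀ j, j < K - J →
              (blockAvg (P := F.P K) (j := j) ℰp).avg (GaugeField.gaugeAct (g j) (Averaging.iter (fun k => blockAvg (P := F.P K) (j := k) ℰp) j U)) =
                GaugeField.gaugeAct (g (j + 1)) (Averaging.iter (fun k => blockAvg (P := F.P K) (j := k) ℰp) (j + 1) U)) →
            (∀ j, j < K - J → ∀ x, g₀ j x =
              (axialT (lift j (GaugeField.gaugeAct (g₀ (j + 1)) (Averaging.iter (fun k => blockAvg (P := F.P K) (j := k) ℰp) (j + 1) U₀)))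
                  (emb (blockOf x)) x)⁻¹ *
                g₀ (j + 1) (blockOf x) * axialT (Averaging.iter (fun k => blockAvg (P := F.P K) (j := k) ℰp) j U₀) (emb (blockOf x)) x) →
            (∀ j, K - J ≤ j → ∀ y, g₀ j y = 1) →
            (∀ j, j < K - J → ∀ y : Site (F.P K) (j + 1), g₀ j (emb y) = g₀ (j + 1) y) →
            (∀ X : GaugeField (F.P K) 0 SU2, ∀ j, j ≤ K - J →
              Averaging.iter (fun k => blockAvg (P := F.P K) (j := k) ℰp) j (GaugeField.gaugeAct (g₀ 0) X) =
                GaugeField.gaugeAct (g₀ j) (Averaging.iter (fun k => blockAvg (P := F.P K) (j := k) ℰp) j X)) →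
            (∀ j, j < K - J → ∀ x,
              axialT (GaugeField.gaugeAct (g₀ j) (Averaging.iter (fun k => blockAvg (P := F.P K) (j := k) ℰp) j U₀)) (emb (blockOf x)) x =
                axialT (lift j (GaugeField.gaugeAct (g₀ (j + 1)) (Averaging.iter (fun k => blockAvg (P := F.P K) (j := k) ℰp) (j + 1) U₀)))
                  (emb (blockOf x)) x) →
            (∀ j, j < K - J →
              (blockAvg (P := F.P K) (j := j) ℰp).avg (GaugeField.gaugeAct (g₀ j) (Averaging.iter (fun k => blockAvg (P := F.P K) (j := k) ℰp) j U₀)) =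
                GaugeField.gaugeAct (g₀ (j + 1)) (Averaging.iter (fun k => blockAvg (P := F.P K) (j := k) ℰp) (j + 1) U₀)) →
            ∃ (r e : ℕ → ℝ) (W : ℕ → ℕ → ℝ), (∀ j, 0 ≤ r j) ∧ (∀ j, 0 ≤ e j) ∧ (∀ j u, 0 ≤ W j u) ∧ ∑ j ∈ range (K - J), (r j + e j) ≤ E ∧
              Real.exp E * ∑ j ∈ range (K - J), ∑ u ∈ range (j + 1), Real.sqrt (F.L : ℝ) ^ (j - u) * W j u ≤ 1 / 2 ∧
              ∀ j, j < K - J →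
                √(∑ b, ‖logVec (su2Quat (GaugeField.gaugeAct (g (j + 1)) (Averaging.iter (fun k => blockAvg (P := F.P K) (j := k) ℰp) (j + 1) U) b)) -
                      logVec (su2Quat (GaugeField.gaugeAct (g₀ (j + 1)) (Averaging.iter (fun k => blockAvg (P := F.P K) (j := k) ℰp) (j + 1) U₀) b))‖ ^ 2) ≤
                  (1 + r j) * √(∑ b, dist1 (GaugeField.gaugeAct (g (j + 1)) (Averaging.iter (fun k => blockAvg (P := F.P K) (j := k) ℰp) (j + 1) U) b *
                    (GaugeField.gaugeAct (g₀ (j + 1)) (Averaging.iter (fun k => blockAvg (P := F.P K) (j := k) ℰp) (j + 1) U₀) b)⁻¹) ^ 2) ∧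
                √(∑ b, dist1 (GaugeField.gaugeAct (g j) (Averaging.iter (fun k => blockAvg (P := F.P K) (j := k) ℰp) j U) b *
                      (lift j (GaugeField.gaugeAct (g (j + 1)) (Averaging.iter (fun k => blockAvg (P := F.P K) (j := k) ℰp) (j + 1) U)) b)⁻¹ *
                    (GaugeField.gaugeAct (g₀ j) (Averaging.iter (fun k => blockAvg (P := F.P K) (j := k) ℰp) j U₀) b *
                      (lift j (GaugeField.gaugeAct (g₀ (j + 1)) (Averaging.iter (fun k => blockAvg (P := F.P K) (j := k) ℰp) (j + 1) U₀)) b)⁻¹)⁻¹) ^ 2) ≤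
                  Real.sqrt (F.L : ℝ) * e j * √(∑ b, dist1 (GaugeField.gaugeAct (g (j + 1)) (Averaging.iter (fun k => blockAvg (P := F.P K) (j := k) ℰp) (j + 1) U) b *
                    (GaugeField.gaugeAct (g₀ (j + 1)) (Averaging.iter (fun k => blockAvg (P := F.P K) (j := k) ℰp) (j + 1) U₀) b)⁻¹) ^ 2) +
                    (C * Real.sqrt (F.L : ℝ) ^ j *
                      √(∑ p, dist1 ((GaugeField.plaqHol (GaugeField.gaugeAct (g₀ 0) U₀) p)⁻¹ * GaugeField.plaqHol (GaugeField.gaugeAct (g 0) U) p) ^ 2) +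
                     ∑ u ∈ range (j + 1), W j u * √(∑ b, dist1 (GaugeField.gaugeAct (g u) (Averaging.iter (fun k => blockAvg (P := F.P K) (j := k) ℰp) u U) b *
                        (GaugeField.gaugeAct (g₀ u) (Averaging.iter (fun k => blockAvg (P := F.P K) (j := k) ℰp) u U₀) b)⁻¹) ^ 2))) :
    ∀ (L : ℕ), ∃ c₀ : ℝ, 0 < c₀ ∧ c₀ ≤ 1 ∧ ∀ (cw : ℝ), 0 < cw → cw ≤ c₀ → ∃ pS : ℝ, ∀ (b₀ p₀ : ℝ), 0 < b₀ → pS ≤ p₀ → 0 < p₀ → ∃ ε₁ : ℝ, 0 < ε₁ ∧ ∀ (ε₀ : ℝ), 0 < ε₀ → ε₀ ≤ ε₁ →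
    ∃ γ₁ : ℝ, 0 < γ₁ ∧ ∃ C_D : ℝ, 0 < C_D ∧ ∀ (F : T3Family) (γ : ℝ), F.L = L → 0 < γ → γ ≤ γ₁ →
      ∀ (J K : ℕ) (hJK : J ≤ K) (V : GaugeField (F.P J) 0 (Matrix.specialUnitaryGroup (Fin 2) ℂ)), PlaqSmall (θBal F.L γ (cw * b₀) p₀ J) V →
        G F J V →
        ∀ U₀ ∈ {U' : GaugeField (F.P K) 0 (Matrix.specialUnitaryGroup (Fin 2) ℂ) | U' ∈ fibre F ℰp J K hJK V ∧ U' ∈ histGood F ℰp (θBal F.L γ b₀ p₀) K J ∧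
            wilsonAction4 U' = minActionRegPr F J K hJK ε₀ V},
        ∀ U ∈ fibre F ℰp J K hJK V, U ∈ histGood F ℰp (θBal F.L γ b₀ p₀) K J →
        (          ∃ (wt : (j : ℕ) → PBond (F.P K) j → PBond (F.P K) (j + 1) → ℝ)
            (lift : (j : ℕ) → GaugeField (F.P K) (j + 1) SU2 → GaugeField (F.P K) j SU2)
            (U₁ : GaugeField (F.P K) 0 SU2) (g g₀ : (j : ℕ) → Site (F.P K) j → SU2),
          (∀ j b e, wt j b e = if e.dir = b.dir ∧ (b.src b.dir - emb e.src b.dir).val < (F.P K).L then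
              ∏ ν ∈ Finset.univ.erase b.dir, max 0 (1 - ((rel (emb e.src) b.src ν).natAbs : ℝ) / (F.P K).L) else 0) ∧
          (∀ j X b, lift j X b = expPoint (∑ e, wt j b e • ((((F.P K).L : ℕ) : ℝ)⁻¹ • logVec (su2Quat (X e))))) ∧
          (∀ j, j < K - J → ∀ x, g j x =
            (axialT (lift j (GaugeField.gaugeAct (g (j + 1)) (Averaging.iter (fun k => blockAvg (P := F.P K) (j := k) ℰp) (j + 1) U)))
                (emb (blockOf x)) x)⁻¹ *
              g (j + 1) (blockOf x) * axialT (Averaging.iter (fun k => blockAvg (P := F.P K) (j := k) ℰp) j U) (emb (blockOf x)) x) ∧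
          (∀ j, K - J ≤ j → ∀ y, g j y = 1) ∧
          (∀ j, j < K - J → ∀ y : Site (F.P K) (j + 1), g j (emb y) = g (j + 1) y) ∧
          (∀ X : GaugeField (F.P K) 0 SU2, ∀ j, j ≤ K - J →
            Averaging.iter (fun k => blockAvg (P := F.P K) (j := k) ℰp) j (GaugeField.gaugeAct (g 0) X) =
              GaugeField.gaugeAct (g j) (Averaging.iter (fun k => blockAvg (P := F.P K) (j := k) ℰp) j X)) ∧
          (∀ j, j < K - J → ∀ x,
            axialT (GaugeField.gaugeAct (g j) (Averaging.iter (fun k => blockAvg (P := F.P K) (j := k) ℰp) j U)) (emb (blockOf x)) x =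
              axialT (lift j (GaugeField.gaugeAct (g (j + 1)) (Averaging.iter (fun k => blockAvg (P := F.P K) (j := k) ℰp) (j + 1) U)))
                (emb (blockOf x)) x) ∧
          (∀ j, j < K - J →
            (blockAvg (P := F.P K) (j := j) ℰp).avg (GaugeField.gaugeAct (g j) (Averaging.iter (fun k => blockAvg (P := F.P K) (j := k) ℰp) j U)) =
              GaugeField.gaugeAct (g (j + 1)) (Averaging.iter (fun k => blockAvg (P := F.P K) (j := k) ℰp) (j + 1) U)) ∧
          (∀ j, j < K - J → ∀ x, g₀ j x =
            (axialT (lift j (GaugeField.gaugeAct (g₀ (j + 1)) (Averaging.iter (fun k => blockAvg (P := F.P K) (j := k) ℰp) (j + 1) U₁)))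
                (emb (blockOf x)) x)⁻¹ *
              g₀ (j + 1) (blockOf x) * axialT (Averaging.iter (fun k => blockAvg (P := F.P K) (j := k) ℰp) j U₁) (emb (blockOf x)) x) ∧
          (∀ j, K - J ≤ j → ∀ y, g₀ j y = 1) ∧
          (∀ j, j < K - J → ∀ y : Site (F.P K) (j + 1), g₀ j (emb y) = g₀ (j + 1) y) ∧
          (∀ X : GaugeField (F.P K) 0 SU2, ∀ j, j ≤ K - J →
            Averaging.iter (fun k => blockAvg (P := F.P K) (j := k) ℰp) j (GaugeField.gaugeAct (g₀ 0) X) =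
              GaugeField.gaugeAct (g₀ j) (Averaging.iter (fun k => blockAvg (P := F.P K) (j := k) ℰp) j X)) ∧
          (∀ j, j < K - J → ∀ x,
            axialT (GaugeField.gaugeAct (g₀ j) (Averaging.iter (fun k => blockAvg (P := F.P K) (j := k) ℰp) j U₁)) (emb (blockOf x)) x =
              axialT (lift j (GaugeField.gaugeAct (g₀ (j + 1)) (Averaging.iter (fun k => blockAvg (P := F.P K) (j := k) ℰp) (j + 1) U₁)))
                (emb (blockOf x)) x) ∧
          (∀ j, j < K - J →
            (blockAvg (P := F.P K) (j := j) ℰp).avg (GaugeField.gaugeAct (g₀ j) (Averaging.iter (fun k => blockAvg (P := F.P K) (j := k) ℰp) j U₁)) =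
              GaugeField.gaugeAct (g₀ (j + 1)) (Averaging.iter (fun k => blockAvg (P := F.P K) (j := k) ℰp) (j + 1) U₁)) ∧
          (∀ X : GaugeField (F.P K) 0 SU2, Averaging.iter (fun k => blockAvg (P := F.P K) (j := k) ℰp) (K - J) (GaugeField.gaugeAct (fun x => (g 0 x)⁻¹) X) = Averaging.iter (fun k => blockAvg (P := F.P K) (j := k) ℰp) (K - J) X) ∧
          (∀ X : GaugeField (F.P K) 0 SU2, Averaging.iter (fun k => blockAvg (P := F.P K) (j := k) ℰp) (K - J) (GaugeField.gaugeAct (g₀ 0) X) = Averaging.iter (fun k => blockAvg (P := F.P K) (j := k) ℰp) (K - J) X) ∧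
          U₀ = GaugeField.gaugeAct (fun x => (g 0 x)⁻¹ * g₀ 0 x) U₁) →
        ((F.L : ℝ)⁻¹) ^ (2 * (K - J)) * ∑ ℓ : PBond (F.P K) 0, dist1 (U ℓ * (U₀ ℓ)⁻¹) ^ 2
          ≤ C_D * ∑ p : Plaq (F.P K) 0, (1 - reTr ((GaugeField.plaqHol U₀ p)⁻¹ * GaugeField.plaqHol U p)) := by
  intro L
  obtain ⟨c₀, hc₀, hc₀1, H1⟩ := HLW L
  refine ⟨c₀, hc₀, hc₀1, fun cw hcw hcwle => ?_⟩
  obtain ⟨pS, H1⟩ := H1 cw hcw hcwle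
  refine ⟨pS, fun b₀ p₀ hb hpS hp => ?_⟩
  obtain ⟨ε₁, hε₁, H1⟩ := H1 b₀ p₀ hb hpS hp
  refine ⟨ε₁, hε₁, fun ε₀ hε₀ hε₀le => ?_⟩
  obtain ⟨γ₁, hγ₁, E, C, hC, H1⟩ := H1 ε₀ hε₀ hε₀le
  by_cases hL : 1 < L
  · have hL' : (1 : ℝ) < L := by exact_mod_cast hL
    have hCD : 0 < 8 * (Real.exp E * C / ((L : ℝ) - 1)) ^ 2 := by
      have : 0 < Real.exp E * C / ((L : ℝ) - 1) := div_pos (mul_pos (Real.exp_pos E) hC) (by linarith)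
      positivity
    refine ⟨γ₁, hγ₁, 8 * (Real.exp E * C / ((L : ℝ) - 1)) ^ 2, hCD, fun F γ hFL hγ hγle J K hJK V hV hG U₀ hU₀ U hU hUg hAx => ?_⟩
    obtain ⟨wt, lift, U₁, g, g₀, hw, hlift, h0, h1, h2, h3, h4, h5, h0', h1', h2', h3', h4', h5', hT6, hres', hEq⟩ := hAx
    have hFL' : (F.L : ℝ) = L := by exact_mod_cast hFL
    have hLF : 1 < (F.L : ℝ) := by rw [hFL']; exact hL'
    have hPd : (F.P K).d = 3 := rfl
    have hwres : ∀ X : GaugeField (F.P K) 0 SU2,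
        descendTo F ℰp J K hJK (GaugeField.gaugeAct (fun x => (g 0 x)⁻¹ * g₀ 0 x) X) = descendTo F ℰp J K hJK X := by
      refine residual_of_iter_eq F hJK _ fun X => ?_
      have e1 : GaugeField.gaugeAct (fun x => (g 0 x)⁻¹ * g₀ 0 x) X =
          GaugeField.gaugeAct (fun x => (g 0 x)⁻¹) (GaugeField.gaugeAct (g₀ 0) X) := by
        rw [← gaugeAct_mul_eq]; rfl
      rw [e1, hT6, hres']
    have hU₁ : U₁ ∈ {U' : GaugeField (F.P K) 0 (Matrix.specialUnitaryGroup (Fin 2) ℂ) | U' ∈ fibre F ℰp J K hJK V ∧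
        U' ∈ histGood F ℰp (θBal F.L γ b₀ p₀) K J ∧ wilsonAction4 U' = minActionRegPr F J K hJK ε₀ V} := by
      rw [hEq] at hU₀
      exact (gaugeAct_mem_argmin_iff_of_residual F hJK hwres U₁ V).mp hU₀
    have hletter := H1 F γ hFL hγ hγle J K hJK V hV hG U₁ hU₁ U hU hUg wt lift hw hlift g g₀
      h0 h1 h2 h3 h4 h5 h0' h1' h2' h3' h4' h5'
    have hR1 : ∀ j, j < K - J → ∀ X X' : GaugeField (F.P K) (j + 1) SU2,
        ∑ b, dist1 (lift j X b * (lift j X' b)⁻¹) ^ 2 ≤ (F.L : ℝ) * ∑ e, ‖logVec (su2Quat (X e)) - logVec (su2Quat (X' e))‖ ^ 2 := by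
      intro j hj X X'
      have hj' : j + 1 ≤ (F.P K).m + (F.P K).K := by show j + 1 ≤ F.m + K; omega
      have h := sum_dist1_sq_lift_mul_inv_le hj' (wt j) (hw j) X X' (lift j X) (lift j X') (hlift j X) (hlift j X')
      have hL0 : ((F.P K).L : ℝ) ≠ 0 := (Nat.cast_pos.mpr (F.P K).L_pos).ne'
      rw [hPd, show (((F.P K).L : ℝ)⁻¹) ^ 2 * ((F.P K).L : ℝ) ^ 3 = (F.P K).L by field_simp] at h
      exact h
    have h := (dockRel_of_towers_feedback F hJK hLF U U₁ hU hU₁.1 lift hR1 C E hC g g₀ h1 h1' hT6 hres' hletter).2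
    rw [← hEq] at h
    rw [hFL'] at h ⊢
    exact h
  · exact ⟨γ₁, hγ₁, 1, one_pos, fun F γ hFL => absurd (hFL ▸ F.hL.2) hL⟩

end Summit.QuantumFields.YangMills.Theorems.FluctuationComparisonRegPrIntLS2BetaStageAxialFeedback

end
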